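import Summits.CriticalPhenomena.CardyFormulaZ2.Theses.CardySusyWard
import Summits.CriticalPhenomena.CardyFormulaZ2.Theorems.SLE6LimitZ2AllDiscretisations
import Literature.Probability.LatticeModels.MedialExplorationChains

/-!
# `ParafermionFamiliesToSLESix` (route `CardySusyWard`, stmt-CriticalPhenomena-10814): the second
# hypothesis as typed is the vanishing normalisation

Negative-side support (cdisprove unit, cycle 1) for the provers of the crux
`ParafermionFamiliesToSLESix := WeakHolomorphy → ParafermionPrecompact → (SLE₆ for every Dobrushin
domain and every admissible discretisation family)`.

* `parafermionPrecompact_iff_vanishing` — the by-name hypothesis `ParafermionPrecompact`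
  (stmt-CriticalPhenomena-11293, rev 5 of the route file) is EQUIVALENT to
  "`δ^{-1/3} F_δ → 0` uniformly on compacts along every admissible family": its equicontinuity
  clause ranges over all `z z' : Sym2 (Site 2)`, and every lattice edge `{x, y}` has the non-edge
  junk twin `{2x - y, 2y - x}` with the same medial point, on which `F_δ ≡ 0` because the medial
  exploration path visits lattice edges only (`mem_edgeSet_of_mem_medialExploration`).
* `parafermionFamiliesToSLESix_iff` — hence the crux as typed reads
  `WeakHolomorphy → (vanishing normalisation) → SLE6LimitZ2AllDiscretisations` (the registered
  OPEN conjecture leaf, reached by field repackaging): an asymptotically trivial observable is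
  asked to identify the interface. The intended Morera / martingale identification cannot prove
  this; the item is provable only by refuting one of its hypotheses or by proving the conjecture
  outright, and is not refutable short of disproving conformal invariance of bond percolation on
  `ℤ²` along an admissible family. Repair (planner): edge guards `z, z' ∈ (zdGraph 2).edgeSet` in
  11293, as in the twin `CardyComplexCone.ParafermionToSLESixFamilies` (stmt-11389).
-/

noncomputable section

namespace Summit.CriticalPhenomena.CardyFormulaZ2.Theorems.ParafermionFamiliesToSLESix.Negative

open scoped Topology NNReal
open Filter MeasureTheory Set
open Literature.Probability.LatticeModels Literature.Probability.Percolation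
open Literature.Probability.RandomPlanarGeometry
open Summit.CriticalPhenomena.CardyFormulaZ2.Theses.CardySusyWard

/-! ## Lattice bookkeeping: the exploration path consists of lattice edges -/

/-- Two consecutive entries of a list form an infix. [folklore] -/
theorem infix_pair_getElem' {α : Type*} (l : List α) (i : ℕ) (h : i + 1 < l.length) :
    [l[i], l[i + 1]] <:+: l := by
  refine ⟨l.take i, l.drop (i + 2), ?_⟩
  apply List.ext_getElem
  · simp
  · intro n h1 h2
    simp only [List.append_assoc, List.getElem_append, List.length_take, List.getElem_take,
      List.length_cons, List.length_nil, List.getElem_drop]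
    split_ifs with h3 h4
    · rfl
    · have : n = i ∨ n = i + 1 := by omega
      rcases this with rfl | rfl
      · simp [show min n l.length = n by omega]
      · simp [show min i l.length = i by omega]
    · congr 1; omega

/-- A corner edge is a lattice edge. [folklore] -/
theorem cornerEdge_mem_edgeSet' {v f : Site 2} (hv : IsCorner v f) (i : Fin 2) :
    cornerEdge v f i ∈ (zdGraph 2).edgeSet :=
  (SimpleGraph.mem_edgeSet _).2 (adj_cornerNeighbor hv i)

/-- Every medial vertex visited by an exploration path is a lattice edge (every entry is the
source or the target of a dart, and the path has at least one dart). [folklore] -/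
theorem mem_edgeSet_of_isMedialExploration {E : DiscreteDobrushin} {ω : BondConfig (Site 2)}
    {γ : List MedialVertex} (hγ : IsMedialExploration E ω γ) {z : MedialVertex} (hz : z ∈ γ) :
    z ∈ (zdGraph 2).edgeSet := by
  obtain ⟨k, hk, rfl⟩ := List.getElem_of_mem hz
  -- the path has at least two entries
  have h2 : 1 < γ.length := by
    by_contra h1
    have hlen : γ.length = 1 := by
      have := List.length_pos_of_ne_nil hγ.ne_nil
      omega
    apply hγ.head_ne_getLast
    rw [List.head_eq_getElem, List.getLast_eq_getElem]
    congr 1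
    omega
  by_cases hk' : k + 1 < γ.length
  · obtain ⟨v, f, hvf, -, hs, -⟩ := hγ.step _ _ (infix_pair_getElem' γ k hk')
    obtain ⟨a, b, -, ha, -⟩ := exists_cornerSource_eq_cornerTarget_eq v f
    rw [← hs, ha]; exact cornerEdge_mem_edgeSet' hvf a
  · have hk1 : k - 1 + 1 < γ.length := by omega
    obtain ⟨v, f, hvf, -, -, ht⟩ := hγ.step _ _ (infix_pair_getElem' γ (k - 1) hk1)
    have hkk : k - 1 + 1 = k := by omega
    simp only [hkk] at ht
    obtain ⟨a, b, -, -, hb⟩ := exists_cornerSource_eq_cornerTarget_eq v f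
    rw [← ht, hb]; exact cornerEdge_mem_edgeSet' hvf b

/-- Every medial vertex of `medialExploration E ω` (junk `[]` or the genuine path) is a lattice
edge. [folklore] -/
theorem mem_edgeSet_of_mem_medialExploration {E : DiscreteDobrushin} {ω : BondConfig (Site 2)}
    {z : MedialVertex} (hz : z ∈ medialExploration E ω) : z ∈ (zdGraph 2).edgeSet := by
  rcases medialExploration_eq_nil_or E ω with h | h
  · rw [h] at hz; simp at hz
  · exact mem_edgeSet_of_isMedialExploration h hz

/-- Off the lattice edges the parafermionic summand vanishes identically, hence so does the
observable `F_δ`. [folklore] -/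
theorem integral_passageSum_eq_zero_of_not_mem_edgeSet (E : DiscreteDobrushin) (δ s : ℝ)
    {z : MedialVertex} (hz : z ∉ (zdGraph 2).edgeSet) :
    ∫ ω, MedialPath.passageSum (medialExploration E ω) δ s z ∂(bondPercolation (zdGraph 2) half) = 0 := by
  have : ∀ ω, MedialPath.passageSum (medialExploration E ω) δ s z = 0 := fun ω =>
    MedialPath.passageSum_eq_zero_of_not_mem δ s (fun h => hz (mem_edgeSet_of_mem_medialExploration h))
  simp [this]

/-- The **junk twin** `{2x - y, 2y - x}` of a pair `{x, y}` has the same medial point at every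
mesh. [folklore] -/
theorem medialPoint_junkTwin (δ : ℝ) (x y : Site 2) :
    medialPoint δ s(x + x - y, y + y - x) = medialPoint δ s(x, y) := by
  simp only [medialPoint_mk]
  congr 1
  apply Complex.ext
  · simp only [Complex.add_re, meshPoint_re]
    push_cast [Pi.add_apply, Pi.sub_apply]
    ring
  · simp only [Complex.add_im, meshPoint_im]
    push_cast [Pi.add_apply, Pi.sub_apply]
    ring

/-- The junk twin of a lattice EDGE is not a lattice edge (its endpoints are `3` apart in one
coordinate, adjacent sites at most `1`). [folklore] -/
theorem junkTwin_not_mem_edgeSet {x y : Site 2} (h : (zdGraph 2).Adj x y) :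
    s(x + x - y, y + y - x) ∉ (zdGraph 2).edgeSet := by
  intro hmem
  rw [SimpleGraph.mem_edgeSet] at hmem
  obtain ⟨j, hj⟩ := (zdGraph_adj_iff x y).1 h
  obtain ⟨k, hk⟩ := (zdGraph_adj_iff _ _).1 hmem
  have hj' : y j = x j + 1 ∨ x j = y j + 1 := by
    rcases hj with hj | hj
    · left; simpa using congrFun hj j
    · right; simpa using congrFun hj j
  have hsingle : (Pi.single k (1:ℤ) : Site 2) j = 0 ∨ (Pi.single k (1:ℤ) : Site 2) j = 1 := by
    by_cases hjk : j = k
    · subst hjk; simp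
    · left; simp [hjk]
  have hk' : (y + y - x) j = (x + x - y) j + (Pi.single k (1:ℤ) : Site 2) j ∨
      (x + x - y) j = (y + y - x) j + (Pi.single k (1:ℤ) : Site 2) j := by
    rcases hk with hk | hk
    · left; exact congrFun hk j
    · right; exact congrFun hk j
  simp only [Pi.add_apply, Pi.sub_apply] at hk'
  rcases hj' with hj' | hj' <;> rcases hk' with hk' | hk' <;> rcases hsingle with hs | hs <;> omega

/-- Every lattice edge has a NON-edge twin with the same medial point (on which `F_δ ≡ 0`). [folklore] -/
theorem exists_junk_twin {z : MedialVertex} (hz : z ∈ (zdGraph 2).edgeSet) :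
    ∃ z' : MedialVertex, z' ∉ (zdGraph 2).edgeSet ∧ ∀ δ : ℝ, medialPoint δ z' = medialPoint δ z := by
  induction z using Sym2.ind with
  | h x y =>
    rw [SimpleGraph.mem_edgeSet] at hz
    exact ⟨_, junkTwin_not_mem_edgeSet hz, fun δ => medialPoint_junkTwin δ x y⟩

/-! ## The equivalence -/

/-- **`ParafermionPrecompact` ↔ vanishing normalisation.** As typed (rev 5), the equicontinuity
clause of `ParafermionPrecompact` ranges over ALL `z z' : Sym2 (Site 2)`; pairing a lattice edge
with its junk twin (same medial point, `F_δ = 0` there) gives `‖F_δ(z)‖ ≤ ε δ^{1/3}` eventually for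
every `ε > 0`; conversely the vanishing normalisation gives (i) with `C = 1` and (ii) by the
triangle inequality. [folklore] -/
theorem parafermionPrecompact_iff_vanishing :
    ParafermionPrecompact ↔
      ∀ (D : DobrushinDomain) (Λ : ℝ → DiscreteDobrushin), (∀ δ, (Λ δ).Ω = D.carrier) →
        (∀ δ, (Λ δ).δ = δ) →
        Tendsto (fun δ : ℝ => Metric.hausdorffEDist (Λ δ).arcA (D.arc 0)) (𝓝[>] (0:ℝ)) (𝓝 0) →
        Tendsto (fun δ : ℝ => Metric.hausdorffEDist (Λ δ).arcB (D.arc 1)) (𝓝[>] (0:ℝ)) (𝓝 0) →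
        Tendsto (fun δ : ℝ => Metric.hausdorffEDist (medialPoint δ '' (Λ δ).zdABEdges)
          {D.pt 0, D.pt 1}) (𝓝[>] (0:ℝ)) (𝓝 0) →
        (∀ᶠ δ in 𝓝[>] (0:ℝ), (Λ δ).IsZdAdmissible) →
        ∀ K : Set ℂ, IsCompact K → K ⊆ D.carrier →
          ∀ ε > (0:ℝ), ∀ᶠ δ in 𝓝[>] (0:ℝ), ∀ z : MedialVertex, medialPoint δ z ∈ K →
            ‖(∫ ω, MedialPath.passageSum (medialExploration (Λ δ) ω) δ (1 / 3) z
                ∂(bondPercolation (zdGraph 2) half))‖ ≤ ε * δ ^ ((1:ℝ) / 3) := by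
  constructor
  · intro hP D Λ hΩ hδ hA hB hM hAdm K hK hKΩ ε hε
    obtain ⟨-, hii⟩ := hP D Λ hΩ hδ hA hB hM hAdm K hK hKΩ
    obtain ⟨η, hη, hev⟩ := hii ε hε
    filter_upwards [hev, self_mem_nhdsWithin] with δ hδ' hδpos
    intro z hz
    by_cases hze : z ∈ (zdGraph 2).edgeSet
    · obtain ⟨z', hz'e, hz'p⟩ := exists_junk_twin hze
      have h0 := integral_passageSum_eq_zero_of_not_mem_edgeSet (Λ δ) δ (1 / 3) hz'e
      have key := hδ' z z' hz (by rw [hz'p δ]; exact hz) (by rw [hz'p δ, dist_self]; exact hη)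
      rwa [h0, sub_zero] at key
    · rw [integral_passageSum_eq_zero_of_not_mem_edgeSet (Λ δ) δ (1 / 3) hze, norm_zero]
      exact mul_nonneg hε.le (Real.rpow_nonneg (le_of_lt hδpos) _)
  · intro hV D Λ hΩ hδ hA hB hM hAdm K hK hKΩ
    have hV' := hV D Λ hΩ hδ hA hB hM hAdm K hK hKΩ
    refine ⟨⟨1, ?_⟩, fun ε hε => ⟨1, one_pos, ?_⟩⟩
    · filter_upwards [hV' 1 one_pos] with δ h z hz
      exact h z hz
    · filter_upwards [hV' (ε / 2) (half_pos hε)] with δ h z z' hz hz' _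
      calc _ ≤ ‖∫ ω, MedialPath.passageSum (medialExploration (Λ δ) ω) δ (1 / 3) z
                  ∂(bondPercolation (zdGraph 2) half)‖ +
               ‖∫ ω, MedialPath.passageSum (medialExploration (Λ δ) ω) δ (1 / 3) z'
                  ∂(bondPercolation (zdGraph 2) half)‖ := norm_sub_le _ _
        _ ≤ ε / 2 * δ ^ ((1:ℝ) / 3) + ε / 2 * δ ^ ((1:ℝ) / 3) := add_le_add (h z hz) (h z' hz')
        _ = ε * δ ^ ((1:ℝ) / 3) := by ring

/-- **The crux as typed**: `ParafermionFamiliesToSLESix ↔ (WeakHolomorphy → vanishing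
normalisation → SLE6LimitZ2AllDiscretisations)` (the conclusion of the crux is the registered open
conjecture leaf up to repackaging the six `ZdDiscretisationFamily` fields; the interface is
`bondInterfaceIn D (Λ δ)` definitionally). [folklore] -/
theorem parafermionFamiliesToSLESix_iff :
    ParafermionFamiliesToSLESix ↔
      (WeakHolomorphy →
        (∀ (D : DobrushinDomain) (Λ : ℝ → DiscreteDobrushin), (∀ δ, (Λ δ).Ω = D.carrier) →
          (∀ δ, (Λ δ).δ = δ) →
          Tendsto (fun δ : ℝ => Metric.hausdorffEDist (Λ δ).arcA (D.arc 0)) (𝓝[>] (0:ℝ)) (𝓝 0) →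
          Tendsto (fun δ : ℝ => Metric.hausdorffEDist (Λ δ).arcB (D.arc 1)) (𝓝[>] (0:ℝ)) (𝓝 0) →
          Tendsto (fun δ : ℝ => Metric.hausdorffEDist (medialPoint δ '' (Λ δ).zdABEdges)
            {D.pt 0, D.pt 1}) (𝓝[>] (0:ℝ)) (𝓝 0) →
          (∀ᶠ δ in 𝓝[>] (0:ℝ), (Λ δ).IsZdAdmissible) →
          ∀ K : Set ℂ, IsCompact K → K ⊆ D.carrier →
            ∀ ε > (0:ℝ), ∀ᶠ δ in 𝓝[>] (0:ℝ), ∀ z : MedialVertex, medialPoint δ z ∈ K →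
              ‖(∫ ω, MedialPath.passageSum (medialExploration (Λ δ) ω) δ (1 / 3) z
                  ∂(bondPercolation (zdGraph 2) half))‖ ≤ ε * δ ^ ((1:ℝ) / 3)) →
        Summit.CriticalPhenomena.CardyFormulaZ2.SLE6LimitZ2AllDiscretisations) := by
  rw [show ParafermionFamiliesToSLESix ↔ (WeakHolomorphy → ParafermionPrecompact →
      Summit.CriticalPhenomena.CardyFormulaZ2.SLE6LimitZ2AllDiscretisations) from ?_]
  · rw [parafermionPrecompact_iff_vanishing]
  · constructor
    · intro h hW hP D E hE
      exact h hW hP D E hE.Ω_eq hE.δ_eq hE.tendsto_arcA hE.tendsto_arcB hE.tendsto_zdABEdges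
        hE.eventually_isZdAdmissible
    · intro h hW hP D Λ h1 h2 h3 h4 h5 h6
      exact h hW hP D Λ ⟨h1, h2, h3, h4, h5, h6⟩

end Summit.CriticalPhenomena.CardyFormulaZ2.Theorems.ParafermionFamiliesToSLESix.Negative
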